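import Literature.Probability.LatticeModels.AizenmanWickBoundLocal
import Mathlib.Order.Filter.AtTopBot.Floor
import HarnessLib

/-!
# Deviation of the even moments of the smeared field from Wick's law: the `⟨T_{|f|,L}^{2n-4}⟩` form is false; the pairing form

Topic `Literature/Probability/LatticeModels`; family `crit-ising` (crit-ising.S13). Companion of
`AizenmanWickBoundRefutations` on the status of the named fact `aizenman_evenMoment_deviation_le`
of `HighDimTrivialityMoments` (Part A), which records the display

  `|⟨T_{f,L}^{2n}⟩_β - (2n)!/(2ⁿn!) ⟨T_{f,L}²⟩_βⁿ| ≤ (3/2)(2n)⁴ ⟨T_{|f|,L}^{2n-4}⟩_β ‖f‖_∞⁴ S`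

of

* R. Panis, arXiv:2309.05797, proof of Thm 5.5, first display (p. 21) — **verbatim**, with
  `S = S(β,L,f) = ∑_{x₁,…,x₄ ∈ Λ_{r_f L}} |U₄^β| / Σ_L(β)²` (the tree's `ursellFourSum`), obtained
  there "using Proposition 4.6";
* M. Aizenman, H. Duminil-Copin, *Marginal triviality of the scaling limits of critical 4D Ising
  and `φ⁴₄` models*, Ann. of Math. 194 (2021) = arXiv:1912.07973, §6.3 "Proof of Proposition
  1.4", second display (numbered (6.45) in arXiv v4, p. 42 there; the displays are unnumbered on
  p. 26 of the literature store's held text, the pagination used by `HighDimTrivialityMoments`) —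
  **up to the form of `S`**: there `S = S(L,r,β)` is the quantity of the third display ((6.46)
  in v4), obtained from `∑ |U₄^β|` by the improved tree diagram bound (Thm 1.3, (1.24)) applied
  termwise: products of four two-point functions `⟨σ_xσ_{xᵢ}⟩_β` summed over `x ∈ ℤ⁴`,
  `x₁,…,x₄ ∈ Λ_{rL}`, divided by `Σ_L(β)² B_{L(x₁,…,x₄)}(β)^c`. The display is obtained there
  ("Combined with the improved tree diagram bound (1.24), this inequality has the following
  consequence") from the first display ((6.44) in v4), "the inequality, valid for every `n ≥ 2`
  and derived using the switching lemma in [1, Proposition 12.1]":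
  `0 ≤ 𝒢_n[S_β](x₁,…,x_{2n}) - S_β(x₁,…,x_{2n})
  ≤ -(3/2) ∑_{i<j<k<l} S_β(x₁,…,x̸_i,…,x̸_j,…,x̸_k,…,x̸_l,…,x_{2n}) U₄^β(x_i,x_j,x_k,x_l)`.

For the refutation the form of `S` is immaterial: at fixed `β`, `L`, `r` Panis's `S` is one
fixed finite number (and so is ADC's, a convergent sum in the regime of Prop. 1.4), while the
defect is the `n`-dependence. Below, "(6.44)", "(6.45)" refer to the first and second displays
of ADC §6.3 in the v4 numbering; the theorems concern the tree's `S = ursellFourSum` throughout.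

**The display is false as printed, for every state.** What [1, Prop. 12.1] = Aizenman, Comm.
Math. Phys. 86 (1982), Prop. 12.1 proves — and what Panis, Prop. 4.6 "Deviation from Wick's
law" (p. 20) states: `|S_{2n} - ∑_{pairings} ∏ S₂| ≤ (3/2) ∑_{i<j<k<l} |U₄(x_i,x_j,x_k,x_l)| ·
∑_{pairings of the remaining points} ∏ S₂` — has the Gaussian pairing functional `𝒢_{n-2}[S₂]` of
the remaining `2n-4` points where (6.44) writes the correlation `S_β` of those points. Smeared
against `∏ f(xᵢ/L)`, `𝒢_{n-2}` produces the Gaussian moment `(2n-4)!/(2^{n-2}(n-2)!) ⟨T_{|f|,L}²⟩^{n-2}`,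
whereas `S_{2n-4}` produces `⟨T_{|f|,L}^{2n-4}⟩`, which is *smaller* (Newman's Gaussian
domination) — for a test function concentrated on a single spin by the full factor `(2n-5)!!`.
Concretely (Part 4): for **every** probability measure `μ` on `{±1}^{ℤ^d}` and **every** `L > 0`,
the test function `b_L(z) = max(0, 1 - 2L ∑ᵢ|zᵢ|)` (continuous, vanishing outside
`[-r,r]^d`, `r = 1 ∨ (2L)⁻¹ ≥ 1`) samples only the origin at scale `L`: `T_{b_L,L} = T_{|b_L|,L}
= Σ_L^{-1/2} σ₀`, so `⟨T^{2m}⟩ = Σ_L^{-m}` (`Σ_L ≥ 1` for every probability measure, Part 2),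
`‖b_L‖_∞ = 1`, and the display reads `(2n-1)!! - 1 ≤ (3/2)(2n)⁴ · ∑_{Λ_{rL}⁴} |U₄^μ|`, false for
`n` large since `(2n-1)!! ≥ n!` (Part 3). At `L = 1/2`, `r = 1` (`Λ_{1/2} = {0}`,
`∑|U₄| = |U₄(0,0,0,0)| = 2`) and `n = 7` the two sides are `135134` and `115248`; this instance
(with `n = 8` and the Euclidean bump) is the tree's refutation `not_aizenman_evenMoment_deviation_le`
of `AizenmanWickBoundRefutations` (through the free state at `d = 2`, `β = 0`). The present file
adds that **no restriction of `d`, `β`, the state or the scale `L` rescues the statement**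
(`exists_evenMoment_deviation_gt`, `not_evenMoment_deviation_le_of_mem`): the defect is the
exponentially wrong `n`-dependence, visible at every scale. (The pointwise `S_{2n-4}` form (6.44)
fails at coincident points: `not_pairingUpperBound`, `not_aizenman_pairingSum_sub_nPoint_le`.)

**The corrected statement** (Part 5) is the smeared pairing form, already derived in the tree
from Aizenman's Prop. 12.1 as a property of a state (`WickDeviationBound`,
`abs_integral_normalizedField_pow_sub_le_of_wickDeviationBound(On)` of `AizenmanWickBound(Local)`):
here it is recorded (i) for Panis's infinite-volume state (the free-boundary limit, any `β ≥ 0`,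
any `d`; `…_of_freeCorr`) and (ii) in the setting of the refuted fact, every `μ ∈ 𝒢(β,0)`,
`0 ≤ β ≤ β_c`, `d ≥ 3` (`…_of_facts`), each from the named facts it genuinely rests on —
`aizenman_wickDeviation_le_finite` (Aizenman 1982, Prop. 12.1 in finite volume; not restated
here) and, for (ii), uniqueness of the Gibbs measure below and at `β_c`. No new named fact is
introduced (D-0026); the summation over `n` of the corrected bound (same constant `24`, prefactor
`exp(z²⟨T_{|f|,L}²⟩/2)`) is `abs_mgf_normalizedField_sub_exp_le_of_wickBounds` (`AizenmanWickBound`),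
so nothing downstream of `aizenman_evenMoment_deviation_le` depended on its false form.

## Contents

* Part 1. The bump `bumpOne`, the scaled bump `scaledBump d L` and its normalised field
  (`normalizedField_scaledBump`: `T_{b_L,L} = Σ_L^{-1/2} σ₀`), its moments.
* Part 2. `Σ_L(μ) ≥ 1` for every probability measure (`|Λ_L|` odd ⇒ `(∑_{Λ_L} σ)² ≥ 1`).
* Part 3. `2ⁿ(n!)² ≤ (2n)!` and `(3/2)(2n)⁴U + 1 < (2n-1)!!` for `n` large.
* Part 4. `exists_evenMoment_deviation_gt` (every probability measure, every `L > 0`),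
  `not_evenMoment_deviation_le_of_mem` (every `μ ∈ 𝒢(β,0)`, every `L > 0`).
* Part 5. `abs_integral_normalizedField_pow_sub_le_of_freeCorr`, `…_of_facts`.

## Mathlib

Used: `FloorSemiring.eventually_mul_pow_lt_factorial_sub` (`a cⁿ < n!` eventually),
`Finset.sum_int_mod` / `Int.units_eq_one_or` (parity of a sum of units), `Real.iSup_le`,
`le_ciSup`, `PiLp.continuous_apply` (through `fun_prop`), `Finset.sum_eq_single_of_mem`.
-/

noncomputable section

open MeasureTheory Finset Filter Topology
open scoped Nat

namespace Literature.Probability.LatticeModels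

variable {d : ℕ}

/-! ### Part 1. A test function seeing exactly one lattice site -/

/-- The `ℓ¹`-bump `b(z) = max(0, 1 - ∑ᵢ |zᵢ|)` on `ℝ^d`: continuous, `0 ≤ b ≤ 1`, `b(0) = 1`,
vanishing off the open unit `ℓ¹`-ball. [folklore] -/
def bumpOne (d : ℕ) (z : EuclideanSpace ℝ (Fin d)) : ℝ :=
  max 0 (1 - ∑ i, |z i|)

/-- `b ≥ 0`. [folklore] -/
theorem bumpOne_nonneg (z : EuclideanSpace ℝ (Fin d)) : 0 ≤ bumpOne d z :=
  le_max_left _ _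

/-- `b ≤ 1`. [folklore] -/
theorem bumpOne_le_one (z : EuclideanSpace ℝ (Fin d)) : bumpOne d z ≤ 1 :=
  max_le zero_le_one (sub_le_self _ (Finset.sum_nonneg fun _ _ => abs_nonneg _))

/-- `|b| = b`. [folklore] -/
theorem abs_bumpOne (z : EuclideanSpace ℝ (Fin d)) : |bumpOne d z| = bumpOne d z :=
  abs_of_nonneg (bumpOne_nonneg z)

/-- `b(0) = 1`. [folklore] -/
@[simp] theorem bumpOne_zero : bumpOne d 0 = 1 := by
  simp [bumpOne]

/-- `b` is continuous. [folklore] -/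
@[fun_prop]
theorem continuous_bumpOne : Continuous (bumpOne d) := by
  unfold bumpOne
  fun_prop

/-- If `b(z) ≠ 0` then `∑ᵢ |zᵢ| < 1`. [folklore] -/
theorem sum_abs_lt_one_of_bumpOne_ne_zero {z : EuclideanSpace ℝ (Fin d)}
    (hz : bumpOne d z ≠ 0) : ∑ i, |z i| < 1 := by
  by_contra h
  exact hz (max_eq_left (by linarith [not_lt.mp h]))

/-- `siteVec 0 = 0`. [folklore] -/
theorem siteVec_zero : siteVec (0 : Site d) = 0 := by
  ext i
  simp

/-- At the points `2x`, `x ∈ ℤ^d`, the bump `b` sees only the origin: `b(2x) = 𝟙{x = 0}`.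
[folklore] -/
theorem bumpOne_two_smul_siteVec (x : Site d) :
    bumpOne d ((2 : ℝ) • siteVec x) = if x = 0 then 1 else 0 := by
  split_ifs with hx
  · rw [hx, siteVec_zero, smul_zero, bumpOne_zero]
  · obtain ⟨i, hi⟩ : ∃ i, x i ≠ 0 := Function.ne_iff.mp hx
    unfold bumpOne
    apply max_eq_left
    have h1 : (1 : ℝ) ≤ |((x i : ℤ) : ℝ)| := by exact_mod_cast Int.one_le_abs hi
    have h2 : |((2 : ℝ) • siteVec x) i| ≤ ∑ j, |((2 : ℝ) • siteVec x) j| :=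
      Finset.single_le_sum (f := fun j => |((2 : ℝ) • siteVec x) j|) (fun j _ => abs_nonneg _)
        (Finset.mem_univ i)
    have h3 : |((2 : ℝ) • siteVec x) i| = 2 * |((x i : ℤ) : ℝ)| := by
      simp [abs_mul]
    linarith

/-- **The scaled bump** `b_L(z) = b(2Lz)`: at scale `L` it samples exactly the spin at the origin,
`b_L(x/L) = b(2x) = 𝟙{x = 0}` for `x ∈ ℤ^d`. [folklore] -/
def scaledBump (d : ℕ) (L : ℝ) (z : EuclideanSpace ℝ (Fin d)) : ℝ :=
  bumpOne d ((2 * L) • z)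

/-- `b_L` is continuous. [folklore] -/
theorem continuous_scaledBump (L : ℝ) : Continuous (scaledBump d L) := by
  unfold scaledBump
  fun_prop

/-- `0 ≤ b_L ≤ 1`, so `|b_L| = b_L`. [folklore] -/
theorem abs_scaledBump (L : ℝ) (z : EuclideanSpace ℝ (Fin d)) :
    |scaledBump d L z| = scaledBump d L z :=
  abs_bumpOne _

/-- `b_L` vanishes outside the cube `[-r, r]^d` for every `r ≥ (2L)⁻¹` (`L > 0`). [folklore] -/
theorem scaledBump_support {L r : ℝ} (hL : 0 < L) (hr : (2 * L)⁻¹ ≤ r)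
    (z : EuclideanSpace ℝ (Fin d)) (hz : scaledBump d L z ≠ 0) (i : Fin d) : |z i| ≤ r := by
  have hsum := sum_abs_lt_one_of_bumpOne_ne_zero hz
  have hi : |((2 * L) • z) i| ≤ ∑ j, |((2 * L) • z) j| :=
    Finset.single_le_sum (f := fun j => |((2 * L) • z) j|) (fun j _ => abs_nonneg _)
      (Finset.mem_univ i)
  have h2L : 0 < 2 * L := by positivity
  have heq : |((2 * L) • z) i| = 2 * L * |z i| := by
    rw [PiLp.smul_apply, smul_eq_mul, abs_mul, abs_of_pos h2L]
  have hlt : 2 * L * |z i| < 1 := by linarith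
  have hle : |z i| ≤ (2 * L)⁻¹ := by
    rw [← one_div, le_div_iff₀ h2L]
    linarith
  exact hle.trans hr

/-- `‖b_L‖_∞ = ⨆ |b_L| = 1`. [folklore] -/
theorem iSup_abs_scaledBump (L : ℝ) : (⨆ z, |scaledBump d L z|) = 1 := by
  refine le_antisymm
    (Real.iSup_le (fun z => (abs_scaledBump L z).trans_le (bumpOne_le_one _)) zero_le_one) ?_
  · have hb : BddAbove (Set.range fun z => |scaledBump d L z|) :=
      ⟨1, by
        rintro _ ⟨z, rfl⟩
        exact (abs_scaledBump L z).trans_le (bumpOne_le_one _)⟩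
    calc (1 : ℝ) = |scaledBump d L 0| := by simp [scaledBump]
      _ ≤ ⨆ z, |scaledBump d L z| := le_ciSup hb 0

/-- **The normalised field of `b_L` is the normalised spin at the origin**:
`T_{b_L,L}(σ) = Σ_L^{-1/2} σ₀`. [folklore] -/
theorem normalizedField_scaledBump (μ : Measure (SpinConfig (Site d))) {L r : ℝ} (hL : 0 < L)
    (hr : 0 ≤ r) (hfr : ∀ z, scaledBump d L z ≠ 0 → ∀ i, |z i| ≤ r) (σ : SpinConfig (Site d)) :
    normalizedField μ L (scaledBump d L) σ =
      (Real.sqrt (blockSpinVariance μ L))⁻¹ * spinAt 0 σ := by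
  rw [normalizedField_eq_mul_sum μ hL.ne' hfr σ]
  congr 1
  have h0 : (0 : Site d) ∈ latticeBox d (r / |L⁻¹|) := by
    rw [mem_latticeBox]
    intro i
    simp only [Pi.zero_apply, Int.cast_zero, abs_zero]
    positivity
  rw [Finset.sum_eq_single_of_mem 0 h0 fun x _ hx => ?_]
  · rw [siteVec_zero, smul_zero]
    simp [scaledBump]
  · unfold scaledBump
    rw [smul_smul, show 2 * L * L⁻¹ = 2 by field_simp, bumpOne_two_smul_siteVec, if_neg hx,
      zero_mul]

/-- **The even moments of `T_{b_L,L}`**: `⟨T_{b_L,L}^{2m}⟩_μ = Σ_L(μ)^{-m}` for a probability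
measure `μ` (written with `((√Σ_L)⁻¹)²` for `Σ_L⁻¹`, the junk-free form). [folklore] -/
theorem integral_normalizedField_scaledBump_pow (μ : Measure (SpinConfig (Site d)))
    [IsProbabilityMeasure μ] {L r : ℝ} (hL : 0 < L) (hr : 0 ≤ r)
    (hfr : ∀ z, scaledBump d L z ≠ 0 → ∀ i, |z i| ≤ r) (m : ℕ) :
    ∫ σ, normalizedField μ L (scaledBump d L) σ ^ (2 * m) ∂μ =
      ((Real.sqrt (blockSpinVariance μ L))⁻¹ ^ 2) ^ m := by
  simp_rw [normalizedField_scaledBump μ hL hr hfr, mul_pow, pow_mul, spinAt_sq, one_pow, mul_one]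
  simp

/-- The second moment `⟨T_{b_L,L}²⟩_μ = Σ_L(μ)⁻¹`. [folklore] -/
theorem integral_normalizedField_scaledBump_sq (μ : Measure (SpinConfig (Site d)))
    [IsProbabilityMeasure μ] {L r : ℝ} (hL : 0 < L) (hr : 0 ≤ r)
    (hfr : ∀ z, scaledBump d L z ≠ 0 → ∀ i, |z i| ≤ r) :
    ∫ σ, normalizedField μ L (scaledBump d L) σ ^ 2 ∂μ =
      (Real.sqrt (blockSpinVariance μ L))⁻¹ ^ 2 := by
  simpa using integral_normalizedField_scaledBump_pow μ hL hr hfr 1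

/-! ### Part 2. `Σ_L ≥ 1` for every probability measure (parity) -/

/-- **A sum of an odd number of spins does not vanish**: `(∑_{x ∈ s} σ_x)² ≥ 1` for `|s|` odd
(the sum is an odd integer). [folklore] -/
theorem one_le_sq_sum_spinAt {V : Type*} (s : Finset V) (hs : Odd s.card) (σ : SpinConfig V) :
    1 ≤ (∑ x ∈ s, spinAt x σ) ^ 2 := by
  have hcast : ∑ x ∈ s, spinAt x σ = ((∑ x ∈ s, ((σ x : ℤ)) : ℤ) : ℝ) := by
    rw [Int.cast_sum]
    rfl
  have hodd : Odd (∑ x ∈ s, ((σ x : ℤ))) := by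
    rw [Int.odd_iff, Finset.sum_int_mod]
    have hterm : ∀ x ∈ s, ((σ x : ℤ)) % 2 = 1 := fun x _ => by
      rcases Int.units_eq_one_or (σ x) with h | h <;> simp [h]
    rw [Finset.sum_congr rfl hterm, Finset.sum_const, nsmul_eq_mul, mul_one]
    obtain ⟨m, hm⟩ := hs
    rw [hm]
    push_cast
    omega
  have hne : (∑ x ∈ s, ((σ x : ℤ))) ≠ 0 := by
    rintro h
    rw [h] at hodd
    exact (by decide : ¬ Odd (0 : ℤ)) hodd
  have h1 : (1 : ℝ) ≤ |((∑ x ∈ s, ((σ x : ℤ)) : ℤ) : ℝ)| := by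
    rw [← Int.cast_abs]
    exact_mod_cast Int.one_le_abs hne
  rw [hcast, ← sq_abs]
  nlinarith

/-- `|Λ_L| = (2⌊L⌋+1)^d` is odd (`L ≥ 0`). [folklore] -/
theorem odd_card_latticeBox {L : ℝ} (hL : 0 ≤ L) : Odd (latticeBox d L).card := by
  rw [latticeBox_eq_box hL, card_box]
  exact (odd_two_mul_add_one _).pow

/-- **`Σ_L(μ) ≥ 1` for every probability measure `μ` on `{±1}^{ℤ^d}` and every `L ≥ 0`**
(`|Λ_L|` is odd, so `(∑_{Λ_L} σ_x)² ≥ 1` pointwise; no sign information on the correlations is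
needed, compare `one_le_blockSpinVariance`). [folklore] -/
theorem one_le_blockSpinVariance_of_odd (μ : Measure (SpinConfig (Site d)))
    [IsProbabilityMeasure μ] {L : ℝ} (hL : 0 ≤ L) : 1 ≤ blockSpinVariance μ L := by
  unfold blockSpinVariance
  have hint : Integrable (fun σ : SpinConfig (Site d) => (∑ x ∈ latticeBox d L, spinAt x σ) ^ 2) μ := by
    refine Integrable.of_bound (((Finset.measurable_sum _ fun x _ => measurable_spinAt x).pow_const
      2).aestronglyMeasurable) (((latticeBox d L).card : ℝ) ^ 2) (Eventually.of_forall fun σ => ?_)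
    rw [Real.norm_eq_abs, abs_pow]
    gcongr
    calc |∑ x ∈ latticeBox d L, spinAt x σ| ≤ ∑ x ∈ latticeBox d L, |spinAt x σ| :=
          Finset.abs_sum_le_sum_abs _ _
      _ = (latticeBox d L).card := by simp [abs_spinAt]
  calc (1 : ℝ) = ∫ _, (1 : ℝ) ∂μ := by simp
    _ ≤ _ := integral_mono (integrable_const 1) hint fun σ =>
        one_le_sq_sum_spinAt _ (odd_card_latticeBox hL) σ

/-! ### Part 3. Combinatorial growth: `(2n-1)!! ≥ n!` beats every polynomial -/

/-- `2ⁿ (n!)² ≤ (2n)!`, i.e. `C(2n, n) ≥ 2ⁿ`, i.e. `(2n-1)!! = (2n)!/(2ⁿ n!) ≥ n!`. [folklore] -/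
theorem two_pow_mul_factorial_mul_factorial_le (n : ℕ) : 2 ^ n * n ! * n ! ≤ (2 * n)! := by
  induction n with
  | zero => simp
  | succ n ih =>
    rw [show 2 * (n + 1) = 2 * n + 1 + 1 by ring, Nat.factorial_succ (2 * n + 1),
      Nat.factorial_succ (2 * n), Nat.factorial_succ n]
    calc 2 ^ (n + 1) * ((n + 1) * n !) * ((n + 1) * n !)
        = (2 * n + 1 + 1) * (n + 1) * (2 ^ n * n ! * n !) := by ring
      _ ≤ (2 * n + 1 + 1) * (2 * n + 1) * (2 * n)! := by
          gcongr
          omega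
      _ = (2 * n + 1 + 1) * ((2 * n + 1) * (2 * n)!) := by ring

/-- `n! ≤ (2n)!/(2ⁿ n!)` in `ℝ`. [folklore] -/
theorem factorial_le_doubleFactorial_real (n : ℕ) :
    (n ! : ℝ) ≤ ((2 * n)! : ℝ) / (2 ^ n * n !) := by
  rw [le_div_iff₀ (by positivity)]
  calc (n ! : ℝ) * (2 ^ n * n !) = ((2 ^ n * n ! * n ! : ℕ) : ℝ) := by push_cast; ring
    _ ≤ (2 * n)! := by exact_mod_cast two_pow_mul_factorial_mul_factorial_le n

/-- `n⁴ ≤ 16ⁿ` in `ℝ` (from `n < 2ⁿ`). [folklore] -/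
theorem pow_four_le_sixteen_pow (n : ℕ) : (n : ℝ) ^ 4 ≤ 16 ^ n := by
  have h : (n : ℝ) ≤ 2 ^ n := by exact_mod_cast (Nat.lt_two_pow_self).le
  calc (n : ℝ) ^ 4 ≤ (2 ^ n) ^ 4 := by gcongr
    _ = 16 ^ n := by rw [← pow_mul, mul_comm, pow_mul]; norm_num

/-- **For every `U ≥ 0`, eventually `(3/2)(2n)⁴ U + 1 < (2n)!/(2ⁿ n!)`** (`(2n-1)!!` grows
faster than any polynomial; here through `(3/2)(2n)⁴U + 1 ≤ (24U+1)16ⁿ < n! ≤ (2n-1)!!`).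
[folklore] -/
theorem exists_poly_lt_doubleFactorial (U : ℝ) (hU : 0 ≤ U) :
    ∃ k : ℕ, 3 / 2 * (2 * (k + 2 : ℕ) : ℝ) ^ 4 * U + 1 <
      ((2 * (k + 2))! : ℝ) / (2 ^ (k + 2) * (k + 2)!) := by
  obtain ⟨k, hk⟩ := (FloorSemiring.eventually_mul_pow_lt_factorial_sub
    ((24 * U + 1) * 16 ^ 2) (16 : ℝ) 0).exists
  refine ⟨k, ?_⟩
  simp only [Nat.sub_zero] at hk
  have h16 : (1 : ℝ) ≤ 16 ^ (k + 2) := one_le_pow₀ (by norm_num)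
  have hn4 := pow_four_le_sixteen_pow (k + 2)
  have hfac : ((k)! : ℝ) ≤ ((k + 2)! : ℝ) := by exact_mod_cast Nat.factorial_le (by omega)
  calc 3 / 2 * (2 * (k + 2 : ℕ) : ℝ) ^ 4 * U + 1
      = 24 * ((k + 2 : ℕ) : ℝ) ^ 4 * U + 1 := by ring
    _ ≤ 24 * 16 ^ (k + 2) * U + 16 ^ (k + 2) := by gcongr
    _ = (24 * U + 1) * 16 ^ 2 * 16 ^ k := by ring
    _ < (k ! : ℝ) := hk
    _ ≤ ((k + 2)! : ℝ) := hfac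
    _ ≤ _ := factorial_le_doubleFactorial_real (k + 2)

/-! ### Part 4. The `⟨T_{|f|,L}^{2n-4}⟩` form of the moment bound fails for every state -/

/-- **For every probability measure `μ` on `{±1}^{ℤ^d}` and every scale `L > 0`, the first
display of the proof of Panis 2023, Thm 5.5 (= the second display (6.45) of Aizenman–Duminil-Copin
2021, §6.3, up to the form of `S`) — the statement vendored as `aizenman_evenMoment_deviation_le` —
fails for some admissible test function and some `n`.** Take `f = b_L` (`scaledBump`, `r = 1 ∨ (2L)⁻¹`): then
`T_{f,L} = T_{|f|,L} = Σ_L^{-1/2} σ₀`, `⟨T^{2m}⟩ = Σ_L^{-m}`, `‖f‖_∞ = 1`,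
`S(μ;L,r) = 𝒰/Σ_L²` with `𝒰 = ∑_{Λ_{rL}⁴} |U₄^μ|`, and the bound reads
`(2n-1)!! - 1 ≤ (3/2)(2n)⁴ 𝒰`, which fails for `n` large (`exists_poly_lt_doubleFactorial`).
The mechanism: smearing the pairing functional `𝒢_{n-2}` of the remaining points (Aizenman 1982,
Prop. 12.1 = Panis 2023, Prop. 4.6) gives the Gaussian moment `(2n-5)!! ⟨T_{|f|,L}²⟩^{n-2}`,
not `⟨T_{|f|,L}^{2n-4}⟩`, which is smaller (Newman) — by the factor `(2n-5)!!` for a field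
concentrated on one spin. [cite: AizenmanDuminilCopinAnnals2021, arXiv:1912.07973 §6.3, first two displays (p. 26 of the held text; eqs. (6.44)–(6.45), p. 42 of arXiv v4)] [cite: Panis2023Triviality, Prop. 4.6 (p. 20) and proof of Thm. 5.5, first display (p. 21)] -/
theorem exists_evenMoment_deviation_gt (μ : Measure (SpinConfig (Site d))) [IsProbabilityMeasure μ]
    {L : ℝ} (hL : 0 < L) :
    ∃ (r : ℝ) (f : EuclideanSpace ℝ (Fin d) → ℝ) (n : ℕ), 1 ≤ r ∧ Continuous f ∧
      (∀ x, f x ≠ 0 → ∀ i, |x i| ≤ r) ∧ 2 ≤ n ∧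
      3 / 2 * (2 * n : ℝ) ^ 4 *
            (∫ σ, normalizedField μ L (fun x => |f x|) σ ^ (2 * n - 4) ∂μ) *
            (⨆ x, |f x|) ^ 4 * ursellFourSum μ L r <
        |(∫ σ, normalizedField μ L f σ ^ (2 * n) ∂μ) -
          ((2 * n)! : ℝ) / (2 ^ n * n !) * (∫ σ, normalizedField μ L f σ ^ 2 ∂μ) ^ n| := by
  -- the test function and its support radius
  set r : ℝ := max 1 (2 * L)⁻¹ with hr_def
  have hr1 : 1 ≤ r := le_max_left _ _
  have hr0 : 0 ≤ r := zero_le_one.trans hr1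
  have hfr : ∀ z, scaledBump d L z ≠ 0 → ∀ i, |z i| ≤ r := fun z hz i =>
    scaledBump_support hL (le_max_right _ _) z hz i
  -- the (finite) sum of `|U₄|` over `Λ_{rL}⁴` and the choice of `n = k + 2`
  set U : ℝ := ∑ x ∈ Fintype.piFinset (fun _ : Fin 4 => latticeBox d (r * L)),
    |connectedFour μ spinAt x| with hU_def
  have hU0 : 0 ≤ U := Finset.sum_nonneg fun x _ => abs_nonneg _
  obtain ⟨k, hk⟩ := exists_poly_lt_doubleFactorial U hU0
  refine ⟨r, scaledBump d L, k + 2, hr1, continuous_scaledBump L, hfr, by omega, ?_⟩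
  -- evaluate `‖f‖_∞` and all the moments
  have habs : (fun x => |scaledBump d L x|) = scaledBump d L := funext (abs_scaledBump L)
  have h2n : 2 * (k + 2) - 4 = 2 * k := by omega
  rw [iSup_abs_scaledBump, habs, h2n, integral_normalizedField_scaledBump_pow μ hL hr0 hfr,
    integral_normalizedField_scaledBump_pow μ hL hr0 hfr,
    integral_normalizedField_scaledBump_sq μ hL hr0 hfr, one_pow, mul_one]
  -- `Σ_L ≥ 1`, `s = Σ_L⁻¹ > 0`, `S(μ;L,r) = 𝒰 / Σ_L²`
  set S : ℝ := blockSpinVariance μ L with hS_def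
  have hS1 : 1 ≤ S := one_le_blockSpinVariance_of_odd μ hL.le
  have hS0 : 0 < S := one_pos.trans_le hS1
  set s : ℝ := (Real.sqrt S)⁻¹ ^ 2 with hs_def
  have hsS : s = S⁻¹ := by rw [hs_def, inv_pow, Real.sq_sqrt hS0.le]
  have hs0 : 0 < s := by rw [hsS]; positivity
  have hSU : ursellFourSum μ L r = U / S ^ 2 := rfl
  rw [hSU]
  -- the comparison `(3/2)(2n)⁴ 𝒰 · sⁿ < ((2n-1)!! - 1) · sⁿ`
  set D : ℝ := ((2 * (k + 2))! : ℝ) / (2 ^ (k + 2) * (k + 2)!) with hD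
  have hPU : 0 ≤ 3 / 2 * (2 * (k + 2 : ℕ) : ℝ) ^ 4 * U := by positivity
  have hlhs : 3 / 2 * (2 * (k + 2 : ℕ) : ℝ) ^ 4 * s ^ k * (U / S ^ 2) =
      3 / 2 * (2 * (k + 2 : ℕ) : ℝ) ^ 4 * U * s ^ (k + 2) := by
    rw [hsS, pow_add, inv_pow]
    ring
  have hrhs : |s ^ (k + 2) - D * s ^ (k + 2)| = (D - 1) * s ^ (k + 2) := by
    rw [← one_sub_mul, abs_mul, abs_of_nonneg (pow_nonneg hs0.le _),
      abs_of_nonpos (by linarith), neg_sub]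
  rw [hlhs, hrhs]
  exact mul_lt_mul_of_pos_right (by linarith) (pow_pos hs0 _)

/-- **No restriction of the parameters rescues `aizenman_evenMoment_deviation_le`**: for every
`d`, `β`, every state `μ ∈ 𝒢(β, 0)` and every `L > 0` the one-state form of the bound fails for
some admissible `r ≥ 1`, `f`, `n ≥ 2` — in particular for `d = 4`, `β = β_c`, `L > 1`, the regime
of Aizenman–Duminil-Copin 2021, Prop. 1.4, and not only at the instance `d = 2`, `β = 0`,
`L = 1/2` of the tree's refutation `not_aizenman_evenMoment_deviation_le`
(`AizenmanWickBoundRefutations`). [cite: AizenmanDuminilCopinAnnals2021, arXiv:1912.07973 §6.3, second display (p. 26 of the held text; eq. (6.45), p. 42 of arXiv v4)] -/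
theorem not_evenMoment_deviation_le_of_mem {β : ℝ} {μ : Measure (SpinConfig (Site d))}
    (hμ : μ ∈ isingGibbsMeasures d β 0) {L : ℝ} (hL : 0 < L) :
    ¬ ∀ r : ℝ, 1 ≤ r → ∀ f : EuclideanSpace ℝ (Fin d) → ℝ, Continuous f →
      (∀ x, f x ≠ 0 → ∀ i, |x i| ≤ r) → ∀ n : ℕ, 2 ≤ n →
      |(∫ σ, normalizedField μ L f σ ^ (2 * n) ∂μ) -
          ((2 * n)! : ℝ) / (2 ^ n * n !) * (∫ σ, normalizedField μ L f σ ^ 2 ∂μ) ^ n|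
        ≤ 3 / 2 * (2 * n : ℝ) ^ 4 *
            (∫ σ, normalizedField μ L (fun x => |f x|) σ ^ (2 * n - 4) ∂μ) *
            (⨆ x, |f x|) ^ 4 * ursellFourSum μ L r := by
  haveI : IsProbabilityMeasure μ := hμ.1
  intro h
  obtain ⟨r, f, n, hr, hf, hfr, hn, hlt⟩ := exists_evenMoment_deviation_gt μ hL
  exact (not_lt.mpr (h r hr f hf hfr n hn)) hlt

/-! ### Part 5. The corrected statement: the smeared pairing form -/

/-- **The corrected moment bound for the infinite-volume state of Panis 2023** (the weak limit of
the free-boundary finite-volume measures, p. 6: any `μ` whose correlations are the free box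
limits `⟨σ_A⟩^∅_{β,0}`, `β ≥ 0`, any `d`): granted Aizenman 1982, Prop. 12.1 in finite volume
(`aizenman_wickDeviation_le_finite`, the tree's named fact; Panis Prop. 4.6 is its infinite-volume
form), for `L > 0`, `f` continuous vanishing outside `[-r,r]^d` and `n ≥ 2`,
`|⟨T_{f,L}^{2n}⟩ - (2n)!/(2ⁿn!) ⟨T_{f,L}²⟩ⁿ|
   ≤ (3/2)(2n)⁴ ‖f‖_∞⁴ S(μ;L,r) · (2n-4)!/(2^{n-2}(n-2)!) ⟨T_{|f|,L}²⟩^{n-2}`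
— the smeared form of Prop. 4.6, i.e. the first display of the proof of Panis Thm 5.5 / ADC
(6.45) with the Gaussian moment of `T_{|f|,L}` in place of `⟨T_{|f|,L}^{2n-4}⟩` (compare
`not_aizenman_evenMoment_deviation_le`). Passage to the limit: `wickDeviationBound_of_finite`;
smearing: `abs_integral_normalizedField_pow_sub_le_of_wickDeviationBound`. [cite: Panis2023Triviality, Prop. 4.6 (p. 20) and proof of Thm. 5.5, first display (p. 21)] [cite: AizenmanCMP1982, Prop. 12.1] -/
theorem abs_integral_normalizedField_pow_sub_le_of_freeCorr (hW : aizenman_wickDeviation_le_finite)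
    {β : ℝ} (hβ : 0 ≤ β) {μ : Measure (SpinConfig (Site d))} [IsProbabilityMeasure μ]
    (hcorr : ∀ A : Finset (Site d), spinCorr μ A = freeCorr d β 0 A) {L r : ℝ} (hL : 0 < L)
    {f : EuclideanSpace ℝ (Fin d) → ℝ} (hf : Continuous f) (hfr : ∀ x, f x ≠ 0 → ∀ i, |x i| ≤ r)
    {n : ℕ} (hn : 2 ≤ n) :
    |(∫ σ, normalizedField μ L f σ ^ (2 * n) ∂μ) -
        ((2 * n)! : ℝ) / (2 ^ n * n !) * (∫ σ, normalizedField μ L f σ ^ 2 ∂μ) ^ n|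
      ≤ 3 / 2 * (2 * n : ℝ) ^ 4 * (⨆ x, |f x|) ^ 4 * ursellFourSum μ L r *
          (((2 * (n - 2))! : ℝ) / (2 ^ (n - 2) * (n - 2)!) *
            (∫ σ, normalizedField μ L (fun x => |f x|) σ ^ 2 ∂μ) ^ (n - 2)) :=
  abs_integral_normalizedField_pow_sub_le_of_wickDeviationBound
    (wickDeviationBound_of_finite hW hβ hcorr) hL hf hfr hn

/-- **The corrected statement in the setting of `aizenman_evenMoment_deviation_le`** (every DLR
state `μ ∈ 𝒢(β,0)`, `0 ≤ β ≤ β_c`), for `d ≥ 3`, from the named facts it rests on: Aizenman 1982,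
Prop. 12.1 in finite volume (`aizenman_wickDeviation_le_finite`) and uniqueness of the Gibbs
measure below and at `β_c` (`hasUniqueGibbsMeasure_of_lt_criticalBeta`,
`hasUniqueGibbsMeasure_criticalBeta`, the latter printed for `d ≥ 3`), which identify `μ` with
the free state (`exists_freeMeasure_holds`, a theorem):
`|⟨T_{f,L}^{2n}⟩_μ - (2n)!/(2ⁿn!) ⟨T_{f,L}²⟩_μⁿ|
   ≤ (3/2)(2n)⁴ ‖f‖_∞⁴ S(μ;L,r) · (2n-4)!/(2^{n-2}(n-2)!) ⟨T_{|f|,L}²⟩_μ^{n-2}`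
(Aizenman–Duminil-Copin 2021, §6.3, (6.44)–(6.45) with `𝒢_{n-2}[S_β]` for `S_β` on the right of
(6.44), as in [Aiz82, Prop. 12.1] which (6.44) quotes, and correspondingly the Gaussian moment in
(6.45)). [cite: AizenmanDuminilCopinAnnals2021, arXiv:1912.07973 §6.3, first two displays (p. 26 of the held text; eqs. (6.44)–(6.45), p. 42 of arXiv v4)] [cite: AizenmanCMP1982, Prop. 12.1] [cite: Panis2023Triviality, Prop. 4.6] -/
theorem abs_integral_normalizedField_pow_sub_le_of_facts (hW : aizenman_wickDeviation_le_finite)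
    (hU₁ : ∀ {d : ℕ} {β : ℝ}, hasUniqueGibbsMeasure_of_lt_criticalBeta (d := d) (β := β))
    (hU₂ : ∀ {d : ℕ}, hasUniqueGibbsMeasure_criticalBeta (d := d))
    (hd : 3 ≤ d) {β L r : ℝ} (hβ : 0 ≤ β) (hβc : β ≤ criticalBeta d) (hL : 0 < L)
    {μ : Measure (SpinConfig (Site d))} (hμ : μ ∈ isingGibbsMeasures d β 0)
    {f : EuclideanSpace ℝ (Fin d) → ℝ} (hf : Continuous f) (hfr : ∀ x, f x ≠ 0 → ∀ i, |x i| ≤ r)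
    {n : ℕ} (hn : 2 ≤ n) :
    |(∫ σ, normalizedField μ L f σ ^ (2 * n) ∂μ) -
        ((2 * n)! : ℝ) / (2 ^ n * n !) * (∫ σ, normalizedField μ L f σ ^ 2 ∂μ) ^ n|
      ≤ 3 / 2 * (2 * n : ℝ) ^ 4 * (⨆ x, |f x|) ^ 4 * ursellFourSum μ L r *
          (((2 * (n - 2))! : ℝ) / (2 ^ (n - 2) * (n - 2)!) *
            (∫ σ, normalizedField μ L (fun x => |f x|) σ ^ 2 ∂μ) ^ (n - 2)) := by
  classical
  haveI : IsProbabilityMeasure μ := hμ.1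
  obtain ⟨μf, hμf, -, hcorr⟩ := exists_freeMeasure_holds d (β := β) 0 hβ le_rfl
  have huniq : HasUniqueGibbsMeasure (isingSpecification (zdGraph d) β 0) := by
    rcases hβc.lt_or_eq with hlt | heq
    · exact hU₁ (by omega) hβ hlt
    · rw [heq]
      exact hU₂ hd
  have hμeq : μ = μf := huniq.1 hμ hμf
  subst hμeq
  exact abs_integral_normalizedField_pow_sub_le_of_freeCorr hW hβ hcorr hL hf hfr hn

end Literature.Probability.LatticeModels

end
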